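import Literature.MathematicalPhysics.QuantumFieldTheory.Balaban1983to89.B9SectBCodedReadingsU
import Literature.MathematicalPhysics.QuantumFieldTheory.Balaban1983to89.B9SectBEGlobAnStepRecordOn

/-!
# `Balaban1983to89.B9SectBStepsKSCU` — the Sect.-B block-steps of the U-LETTER coded readings `(KSCU, KACU, C⁻¹)` over the coded carrier, I: the BASE
# IDENTIFICATION with the record (rfl faces), the input domination `hin` with positive constants, and the ANALYTIC-EXTENSION step (pub-ymgap N06 row 13 under
# node00-def-Y's ruling R13-U1 on LOCATED-11)

T. Bałaban, *Propagators for lattice gauge theories in a background field*, Commun. Math. Phys. **99** (1985) 389–434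
[`Balaban1985BackgroundPropagators`, "B9"]; [4] = T. Bałaban, *Propagators and renormalization transformations for lattice gauge
theories. II*, Commun. Math. Phys. **96** (1984) 223–250 [`Balaban1984PropagatorsII`].

statement-level skeleton of published theorems with citation tags; proofs where landed; nothing here is a claim about the
Yang–Mills mass gap

THE PRINTED LOCI.  Theorem 3.4 p. 400; Sect. B pp. 400–407; (3.42)–(3.48) pp. 397–398; p. 403 l.1–9.

WHY THIS FILE (seat dag-n06-c gen 11).  The row-13 target of record is `B9SectBCodedReadingsU.SectBStepU` (print's reading: letters at the base `U`, operator at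
`U′U`).  Its INPUT side at a base configuration is the record's Theorem-3.1–3.3 block read along the decoding (§1: every member of `KSCU`∕`KACU` at `base U` IS the
record's at `U`, `rfl`); g7's (3.42) conversion then gives the augmented coded family `KSC`'s block (§2 `hin_KSCU_on_pos`, positive constants, from
`B9SectBEGlobAnStepRecordOn.hin_KSC_on_pos`); the analytic-extension step for `(KSCU, KACU, C⁻¹)` at the coded pin `IsAnKY` follows from g8's frame by the generic
transfer (§3, the predicate does not read the families).  The (3.42)∕(3.47)∕(3.46)∕Hölder OUTPUT steps for `KSCU` follow in the sequel(s).
HONEST SCOPE.  Bookkeeping over landed modules; nothing of [B9] asserted; COUNT-NEUTRAL; N06 NOT discharged; one finite lattice programme — nothing continuum, nothing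
about OS positivity or the mass gap.
-/

noncomputable section

namespace Literature.MathematicalPhysics.QuantumFieldTheory.Balaban1983to89.B9SectBStepsKSCU

open Literature.MathematicalPhysics.QuantumFieldTheory.Balaban1983to89.B6Ineq2142KLevelV1 (β)
open Literature.MathematicalPhysics.QuantumFieldTheory.Balaban1983to89.B9SectBCodedCarrier (CCfg Coding pullK pullS)
open Literature.MathematicalPhysics.QuantumFieldTheory.Balaban1983to89.B9Eq360DeltaPrimeAY (AfldY)
open Literature.MathematicalPhysics.QuantumFieldTheory.Balaban1983to89.B9PinMembersKLevelV1 (MemberY geo9Y bg9Y)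
open Literature.MathematicalPhysics.QuantumFieldTheory.Balaban1983to89.B9SectBGpLettersY (GVal decY)
open Literature.MathematicalPhysics.QuantumFieldTheory.Balaban1983to89.B9SectBGpFrameCodedY (codingYx CplxLettersY)
open Literature.MathematicalPhysics.QuantumFieldTheory.Balaban1983to89.B9SectBGpReadingsY (KSC baseY)
open Literature.MathematicalPhysics.QuantumFieldTheory.Balaban1983to89.B9SectBGpTransferInY (ineq343_345_congr)
open Literature.MathematicalPhysics.QuantumFieldTheory.Balaban1983to89.B9SectBCodedChainAn (IsAnKY)
open Literature.MathematicalPhysics.QuantumFieldTheory.Balaban1983to89.B9SectBCodedReadingsU (KSCU KACU)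
open Literature.MathematicalPhysics.QuantumFieldTheory.Balaban1983to89.B9SectBEGlobAnStepRecordOn (hin_KSC_on_pos stepAnalyticPos1_KSC_on)
open Literature.MathematicalPhysics.QuantumFieldTheory.Balaban1983to89.B9SectBStepPosFamilyTransfer (stepPos_of_family_pos)
open Literature.MathematicalPhysics.QuantumFieldTheory.Balaban1983to89.B9SectBStepWhole (StepAnalyticPos1 StepAnalyticPos stepAnalyticPos_of_halves)
open Literature.MathematicalPhysics.QuantumFieldTheory.Balaban1983to89.Node00 (SiteY BlkY IBondY CfgY SiteParY BondParY BondOpY deltaPrimeAY kernelFamilyS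
  kernelFamilyB GpY)

variable {d ℓ : ℕ} {hd : 1 ≤ d + 1} {hL : Odd (ℓ + 1) ∧ 1 < ℓ + 1} {b₀ b₁ : ℝ} {Mstar : ℕ}
variable {𝔸 : Type} [NormedRing 𝔸] [NormedAlgebra ℂ 𝔸] [CompleteSpace 𝔸] [FiniteDimensional ℝ 𝔸]

/-! ## §1 At a base configuration the U-letter readings ARE the record's (read along the decoding) -/

section Base

variable (G : Subgroup 𝔸ˣ) (x : MemberY d ℓ hd hL b₀ b₁ Mstar) (par : SiteParY 𝔸 x.toKIdx) (OA : BondOpY 𝔸 x.toKIdx) (parB : BondParY 𝔸 x.toKIdx)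
  (C37 C38 : ℝ → CfgY 𝔸 x.toKIdx → AfldY 𝔸 x.toKIdx → Prop)

omit [FiniteDimensional ℝ 𝔸] in
/-- the six members of `KSCU` at `base U` are those of the record's G′ family read along the decoding (`rfl` ×6).
[cite: Balaban1985BackgroundPropagators, (3.42)–(3.47) pp.397–398, bookkeeping] -/
theorem KSCU_members_base (U : CfgY 𝔸 x.toKIdx) :
    (∀ n, (KSCU G x par C37 C38).e n (.base U) =
      (pullK (codingYx G x C37 C38) (kernelFamilyS x.toKIdx (bg9Y 𝔸 G x) (fun U => U) (GpY x.toKIdx par) par)).e n (.base U)) ∧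
    (KSCU G x par C37 C38).h1 (.base U) =
      (pullK (codingYx G x C37 C38) (kernelFamilyS x.toKIdx (bg9Y 𝔸 G x) (fun U => U) (GpY x.toKIdx par) par)).h1 (.base U) ∧
    (KSCU G x par C37 C38).e4 (.base U) =
      (pullK (codingYx G x C37 C38) (kernelFamilyS x.toKIdx (bg9Y 𝔸 G x) (fun U => U) (GpY x.toKIdx par) par)).e4 (.base U) ∧
    (KSCU G x par C37 C38).h2 (.base U) =
      (pullK (codingYx G x C37 C38) (kernelFamilyS x.toKIdx (bg9Y 𝔸 G x) (fun U => U) (GpY x.toKIdx par) par)).h2 (.base U) ∧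
    (∀ n, (KSCU G x par C37 C38).l2 n (.base U) =
      (pullK (codingYx G x C37 C38) (kernelFamilyS x.toKIdx (bg9Y 𝔸 G x) (fun U => U) (GpY x.toKIdx par) par)).l2 n (.base U)) ∧
    (∀ n, (KSCU G x par C37 C38).glob n (.base U) =
      (pullK (codingYx G x C37 C38) (kernelFamilyS x.toKIdx (bg9Y 𝔸 G x) (fun U => U) (GpY x.toKIdx par) par)).glob n (.base U)) :=
  ⟨fun _ => rfl, rfl, rfl, rfl, fun _ => rfl, fun _ => rfl⟩

omit [FiniteDimensional ℝ 𝔸] in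
/-- the six members of `KACU` at `base U` are those of the record's G family read along the decoding (`rfl` ×6).
[cite: Balaban1985BackgroundPropagators, (3.42)–(3.47) pp.397–398, (3.84)–(3.86) p.407, bookkeeping] -/
theorem KACU_members_base (U : CfgY 𝔸 x.toKIdx) :
    (∀ n, (KACU G x OA parB C37 C38).e n (.base U) =
      (pullK (codingYx G x C37 C38) (kernelFamilyB x.toKIdx (bg9Y 𝔸 G x) (fun U => U) OA parB)).e n (.base U)) ∧
    (KACU G x OA parB C37 C38).h1 (.base U) = (pullK (codingYx G x C37 C38) (kernelFamilyB x.toKIdx (bg9Y 𝔸 G x) (fun U => U) OA parB)).h1 (.base U) ∧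
    (KACU G x OA parB C37 C38).e4 (.base U) = (pullK (codingYx G x C37 C38) (kernelFamilyB x.toKIdx (bg9Y 𝔸 G x) (fun U => U) OA parB)).e4 (.base U) ∧
    (KACU G x OA parB C37 C38).h2 (.base U) = (pullK (codingYx G x C37 C38) (kernelFamilyB x.toKIdx (bg9Y 𝔸 G x) (fun U => U) OA parB)).h2 (.base U) ∧
    (∀ n, (KACU G x OA parB C37 C38).l2 n (.base U) =
      (pullK (codingYx G x C37 C38) (kernelFamilyB x.toKIdx (bg9Y 𝔸 G x) (fun U => U) OA parB)).l2 n (.base U)) ∧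
    (∀ n, (KACU G x OA parB C37 C38).glob n (.base U) =
      (pullK (codingYx G x C37 C38) (kernelFamilyB x.toKIdx (bg9Y 𝔸 G x) (fun U => U) OA parB)).glob n (.base U)) :=
  ⟨fun _ => rfl, rfl, rfl, rfl, fun _ => rfl, fun _ => rfl⟩

omit [FiniteDimensional ℝ 𝔸] in
/-- two coded families agreeing member-wise at a configuration satisfy the (3.42)∕(3.46)∕(3.47) block together.
[cite: Balaban1985BackgroundPropagators, (3.42), (3.46), (3.47) pp.397–398, bookkeeping] -/
theorem ineq342_346_347_congr (K K' : B9.KernelFamily (geo9Y x) (codingYx G x C37 C38).bg) {c : (codingYx G x C37 C38).bg.Cfg}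
    (he : ∀ n, K.e n c = K'.e n c) (hl2 : ∀ n, K.l2 n c = K'.l2 n c) (hglob : ∀ n, K.glob n c = K'.glob n c) (B₀ δ₀ : ℝ)
    (h : B9.Ineq342_346_347 K B₀ δ₀ c) : B9.Ineq342_346_347 K' B₀ δ₀ c := by
  unfold B9.Ineq342_346_347 at h ⊢
  simp only [← he, ← hl2, ← hglob]
  exact h

omit [FiniteDimensional ℝ 𝔸] in
/-- ★ **THE THEOREM-3.1–3.3 BLOCK AT A BASE TRANSPORTS between `(KSCU, KACU)` and the pulled-back record families** (both directions; the (3.48) family is shared).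
[cite: Balaban1985BackgroundPropagators, (3.42)–(3.48) pp.397–398, bookkeeping] -/
theorem thms_KSCU_base_iff (dC : ℕ) (Cinv : B9.SiteKernel (geo9Y x) (bg9Y 𝔸 G x)) (B₀ δ₀ : ℝ) (Bβ Bε : ℝ → ℝ) (Bεβ : ℝ → ℝ → ℝ) (B₁ δ₁ : ℝ)
    (U : CfgY 𝔸 x.toKIdx) :
    B9.Thms31to33IneqAt dC (KSCU G x par C37 C38) (KACU G x OA parB C37 C38) (pullS (codingYx G x C37 C38) Cinv) B₀ δ₀ Bβ Bε Bεβ B₁ δ₁ (.base U) ↔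
      B9.Thms31to33IneqAt dC
        (pullK (codingYx G x C37 C38) (kernelFamilyS x.toKIdx (bg9Y 𝔸 G x) (fun U => U) (GpY x.toKIdx par) par))
        (pullK (codingYx G x C37 C38) (kernelFamilyB x.toKIdx (bg9Y 𝔸 G x) (fun U => U) OA parB))
        (pullS (codingYx G x C37 C38) Cinv) B₀ δ₀ Bβ Bε Bεβ B₁ δ₁ (.base U) := by
  obtain ⟨se, sh1, se4, sh2, sl2, sg⟩ := KSCU_members_base G x par C37 C38 U
  obtain ⟨ae, ah1, ae4, ah2, al2, ag⟩ := KACU_members_base G x OA parB C37 C38 U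
  constructor
  · rintro ⟨⟨h42, h43⟩, hC, ⟨g42, g43⟩⟩
    exact ⟨⟨ineq342_346_347_congr G x C37 C38 _ _ se sl2 sg B₀ δ₀ h42, ineq343_345_congr G x C37 C38 _ _ sh1 se4 sh2 Bβ Bε Bεβ δ₀ h43⟩, hC,
      ⟨ineq342_346_347_congr G x C37 C38 _ _ ae al2 ag B₀ δ₀ g42, ineq343_345_congr G x C37 C38 _ _ ah1 ae4 ah2 Bβ Bε Bεβ δ₀ g43⟩⟩
  · rintro ⟨⟨h42, h43⟩, hC, ⟨g42, g43⟩⟩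
    exact ⟨⟨ineq342_346_347_congr G x C37 C38 _ _ (fun n => (se n).symm) (fun n => (sl2 n).symm) (fun n => (sg n).symm) B₀ δ₀ h42,
        ineq343_345_congr G x C37 C38 _ _ sh1.symm se4.symm sh2.symm Bβ Bε Bεβ δ₀ h43⟩, hC,
      ⟨ineq342_346_347_congr G x C37 C38 _ _ (fun n => (ae n).symm) (fun n => (al2 n).symm) (fun n => (ag n).symm) B₀ δ₀ g42,
        ineq343_345_congr G x C37 C38 _ _ ah1.symm ae4.symm ah2.symm Bβ Bε Bεβ δ₀ g43⟩⟩

end Base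

/-! ## §2 The input domination for `KSCU` with positive constants -/

section Hin

variable {J : Type} (f : J → MemberY d ℓ hd hL b₀ b₁ Mstar) [∀ x : MemberY d ℓ hd hL b₀ b₁ Mstar, Fintype (geo9Y x).Site]
  (c35 : ℝ) (G : Subgroup 𝔸ˣ) (par : ∀ j : J, SiteParY 𝔸 (f j).toKIdx) (OA : ∀ j : J, BondOpY 𝔸 (f j).toKIdx)
  (parB : ∀ j : J, BondParY 𝔸 (f j).toKIdx) {ι : Type} [Fintype ι] (b : Module.Basis ι ℝ 𝔸)
  (ιB : ∀ j : J, BlkY (f j).toKIdx → IBondY (f j).toKIdx)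
  (C37 C38 : ∀ j : J, ℝ → CfgY 𝔸 (f j).toKIdx → AfldY 𝔸 (f j).toKIdx → Prop)
  (Cinv : ∀ j : J, B9.SiteKernel (geo9Y (f j)) (bg9Y 𝔸 G (f j)))

omit [FiniteDimensional ℝ 𝔸] in
/-- ★ **`hin` FOR `KSCU` WITH POSITIVE OUTPUT CONSTANTS** (input families `(KSCU, KACU, pullS Cinv)`; output: g7's augmented `KSC` with the shared `KACU`, `pullS Cinv`):
at a (3.35)-regular base, §1 identifies the block with the record's read along the decoding, then `B9SectBEGlobAnStepRecordOn.hin_KSC_on_pos`.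
[cite: Balaban1985BackgroundPropagators, Thms 3.1–3.3 (3.42)–(3.48) pp.397–399, (3.35) p.396; Balaban1984PropagatorsII, (2.51) p.232] -/
theorem hin_KSCU_on_pos (hι : ∀ (j : J) (s : BlkY (f j).toKIdx), β (f j).toKIdx.hN (f j).toKIdx.D (f j).toKIdx.hk (ιB j s) = s)
    (hG1 : ∀ u : 𝔸ˣ, u ∈ G → ‖(u : 𝔸)‖ ≤ 1) {M₂ : ℝ} (hM₂ : 0 ≤ M₂) (hrepr : ∀ (v : 𝔸) (j : ι), |b.repr v j| ≤ M₂ * ‖v‖) (dC : ℕ) :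
    ∀ (B₀ δ₀ : ℝ) (Bβ Bε : ℝ → ℝ) (Bεβ : ℝ → ℝ → ℝ) (B₁ δ₁ : ℝ), 0 < B₀ → 0 < δ₀ → 0 < B₁ → 0 < δ₁ →
      ∃ (Mi ai B₀' δ₀' : ℝ) (Bβ' Bε' : ℝ → ℝ) (Bεβ' : ℝ → ℝ → ℝ) (B₁' δ₁' : ℝ), 0 < ai ∧ 0 < B₀' ∧ 0 < δ₀' ∧ 0 < B₁' ∧ 0 < δ₁' ∧
        ∀ j : J, Mi ≤ (geo9Y (f j)).M → ∀ α₀ : ℝ, 0 < α₀ → (geo9Y (f j)).M * α₀ ≤ ai →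
          ∀ c : (codingYx G (f j) (C37 j) (C38 j)).bg.Cfg, (codingYx G (f j) (C37 j) (C38 j)).bg.Reg335 c35 α₀ c →
          B9.Thms31to33IneqAt dC (KSCU G (f j) (par j) (C37 j) (C38 j)) (KACU G (f j) (OA j) (parB j) (C37 j) (C38 j))
              (pullS (codingYx G (f j) (C37 j) (C38 j)) (Cinv j)) B₀ δ₀ Bβ Bε Bεβ B₁ δ₁ c →
          B9.Thms31to33IneqAt dC (KSC G (f j) (par j) (C37 j) (C38 j)) (KACU G (f j) (OA j) (parB j) (C37 j) (C38 j))
              (pullS (codingYx G (f j) (C37 j) (C38 j)) (Cinv j)) B₀' δ₀' Bβ' Bε' Bεβ' B₁' δ₁' c := by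
  intro B₀ δ₀ Bβ Bε Bεβ B₁ δ₁ hB₀ hδ₀ hB₁ hδ₁
  -- g7's conversion for the pulled-back record G′ with the shared families `KACU`, `pullS Cinv`
  obtain ⟨Mi, ai, B₀', δ₀', Bβ', Bε', Bεβ', B₁', δ₁', hai, hB₀', hδ₀', hB₁', hδ₁', H⟩ :=
    hin_KSC_on_pos f c35 G par b ιB C37 C38 hι hG1 hM₂ hrepr dC (fun j => KACU G (f j) (OA j) (parB j) (C37 j) (C38 j))
      (fun j => pullS (codingYx G (f j) (C37 j) (C38 j)) (Cinv j)) B₀ δ₀ Bβ Bε Bεβ B₁ δ₁ hB₀ hδ₀ hB₁ hδ₁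
  refine ⟨Mi, ai, B₀', δ₀', Bβ', Bε', Bεβ', B₁', δ₁', hai, hB₀', hδ₀', hB₁', hδ₁', fun j hM α₀ hα₀ hMa c hreg hT => ?_⟩
  obtain ⟨U, rfl, -⟩ := (codingYx G (f j) (C37 j) (C38 j)).exists_of_bg_Reg335 hreg
  refine H j hM α₀ hα₀ hMa _ hreg ?_
  -- at the base: `KACU` = the pulled-back record G family, `KSCU` = the pulled-back record G′ family
  have h1 := (thms_KSCU_base_iff G (f j) (par j) (OA j) (parB j) (C37 j) (C38 j) dC (Cinv j) B₀ δ₀ Bβ Bε Bεβ B₁ δ₁ U).1 hT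
  -- restore `KACU` as the shared GA family (its members at the base are the record's: the block transports back)
  obtain ⟨⟨h42, h43⟩, hC, ⟨g42, g43⟩⟩ := h1
  obtain ⟨ae, ah1, ae4, ah2, al2, ag⟩ := KACU_members_base G (f j) (OA j) (parB j) (C37 j) (C38 j) U
  exact ⟨⟨h42, h43⟩, hC, ⟨ineq342_346_347_congr G (f j) (C37 j) (C38 j) _ _ (fun n => (ae n).symm) (fun n => (al2 n).symm)
    (fun n => (ag n).symm) B₀ δ₀ g42, ineq343_345_congr G (f j) (C37 j) (C38 j) _ _ ah1.symm ae4.symm ah2.symm Bβ Bε Bεβ δ₀ g43⟩⟩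

/-! ## §3 The analytic-extension step for `(KSCU, KACU, C⁻¹)` at the coded pin `IsAnKY` -/

/-- ★★ **`StepAnalyticPos1` OF `KSCU` over the coded carrier at `IsAnKY`** (input families `(KSCU, KACU, pullS Cinv)`): g8's frame output for `KSC`
(`stepAnalyticPos1_KSC_on` with `GA := KACU`) transported by the generic transfer — `hin_KSCU_on_pos`, identity output (the pin does not read the family).
[cite: Balaban1985BackgroundPropagators, Thm 3.4 p.400, (3.60)–(3.64) p.402, (3.35)–(3.37) p.396; Balaban1984PropagatorsII, Lemma 2.1 p.234] -/
theorem stepAnalyticPos1_KSCU_on [∀ x : MemberY d ℓ hd hL b₀ b₁ Mstar, DecidableEq (geo9Y x).Site]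
    [∀ x : MemberY d ℓ hd hL b₀ b₁ Mstar, Nonempty (geo9Y x).Site] [NormOneClass 𝔸] [DecidableEq ι]
    (hι : ∀ (j : J) (s : BlkY (f j).toKIdx), β (f j).toKIdx.hN (f j).toKIdx.D (f j).toKIdx.hk (ιB j s) = s)
    (hG1 : ∀ u : 𝔸ˣ, u ∈ G → ‖(u : 𝔸)‖ ≤ 1) (hpar : ∀ j (U : CfgY 𝔸 (f j).toKIdx), GVal G (f j).toKIdx U → ∀ z w, par j U z w ∈ G)
    (hunit : ∀ j (U : CfgY 𝔸 (f j).toKIdx), GVal G (f j).toKIdx U → IsUnit (deltaPrimeAY (f j).toKIdx (par j) U))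
    (dB : ℕ) (M₂ : ℝ) (hM₂ : 0 ≤ M₂) (hrepr : ∀ (v : 𝔸) (j : ι), |b.repr v j| ≤ M₂ * ‖v‖) (hcR : 0 < M₂ * ∑ j, ‖b j‖)
    (Cq : ℝ) (hCq : 0 ≤ Cq) (hC37 : ∀ j β' U a, C37 j β' U a → GVal G (f j).toKIdx U ∧ CplxLettersY G (f j) (par j) (ιB j) Cq β' U a)
    (MInv aInv aW : ℝ) (hMInv : 0 < MInv) (haInv : 0 < aInv) (haW : 0 < aW) :
    StepAnalyticPos1 dB c35 (fun j => geo9Y (f j)) (fun j => (codingYx G (f j) (C37 j) (C38 j)).bg)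
      (fun j => KSCU G (f j) (par j) (C37 j) (C38 j)) (fun j => KACU G (f j) (OA j) (parB j) (C37 j) (C38 j))
      (fun j => pullS (codingYx G (f j) (C37 j) (C38 j)) (Cinv j))
      (fun j => IsAnKY G (f j) (par j) b (C37 j) (C38 j)) (fun j => KSCU G (f j) (par j) (C37 j) (C38 j)) := by
  refine stepPos_of_family_pos dB c35 (fun j => geo9Y (f j)) (fun j => (codingYx G (f j) (C37 j) (C38 j)).bg)
    (fun j => KSC G (f j) (par j) (C37 j) (C38 j)) (fun j => KSCU G (f j) (par j) (C37 j) (C38 j))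
    (fun j => KACU G (f j) (OA j) (parB j) (C37 j) (C38 j)) (fun j => KACU G (f j) (OA j) (parB j) (C37 j) (C38 j))
    (fun j => pullS (codingYx G (f j) (C37 j) (C38 j)) (Cinv j))
    (C₁ := PUnit) (C₂ := PUnit) (pos₁ := fun _ => True) (pos₂ := fun _ => True)
    (Out₁ := fun _ j V α => IsAnKY G (f j) (par j) b (C37 j) (C38 j) (KSC G (f j) (par j) (C37 j) (C38 j)) V α)
    (Out₂ := fun _ j V α => IsAnKY G (f j) (par j) b (C37 j) (C38 j) (KSCU G (f j) (par j) (C37 j) (C38 j)) V α)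
    (hin_KSCU_on_pos f c35 G par OA parB b ιB C37 C38 Cinv hι hG1 hM₂ hrepr dB)
    (fun c hc a ha => ⟨0, 1, a, c, one_pos, ha, le_rfl, hc, fun _ _ _ _ _ _ _ _ _ _ h => h⟩)
    (stepAnalyticPos1_KSC_on f c35 G par b ιB C37 C38 hι hG1 hpar hunit dB M₂ hM₂ hrepr hcR Cq hCq hC37 MInv aInv aW hMInv haInv haW _ _)

/-- ★★ **`StepAnalyticPos` (both halves) of `(KSCU, KACU, C⁻¹)` at `IsAnKY`** — the pin ignores the family, so the `KACU` half is the `KSCU` half.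
[cite: Balaban1985BackgroundPropagators, Thm 3.4 p.400, (3.62)–(3.64) p.402, (3.86) p.407] -/
theorem stepAnalyticPos_KSCU_on [∀ x : MemberY d ℓ hd hL b₀ b₁ Mstar, DecidableEq (geo9Y x).Site]
    [∀ x : MemberY d ℓ hd hL b₀ b₁ Mstar, Nonempty (geo9Y x).Site] [NormOneClass 𝔸] [DecidableEq ι]
    (hι : ∀ (j : J) (s : BlkY (f j).toKIdx), β (f j).toKIdx.hN (f j).toKIdx.D (f j).toKIdx.hk (ιB j s) = s)
    (hG1 : ∀ u : 𝔸ˣ, u ∈ G → ‖(u : 𝔸)‖ ≤ 1) (hpar : ∀ j (U : CfgY 𝔸 (f j).toKIdx), GVal G (f j).toKIdx U → ∀ z w, par j U z w ∈ G)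
    (hunit : ∀ j (U : CfgY 𝔸 (f j).toKIdx), GVal G (f j).toKIdx U → IsUnit (deltaPrimeAY (f j).toKIdx (par j) U))
    (dB : ℕ) (M₂ : ℝ) (hM₂ : 0 ≤ M₂) (hrepr : ∀ (v : 𝔸) (j : ι), |b.repr v j| ≤ M₂ * ‖v‖) (hcR : 0 < M₂ * ∑ j, ‖b j‖)
    (Cq : ℝ) (hCq : 0 ≤ Cq) (hC37 : ∀ j β' U a, C37 j β' U a → GVal G (f j).toKIdx U ∧ CplxLettersY G (f j) (par j) (ιB j) Cq β' U a)
    (MInv aInv aW : ℝ) (hMInv : 0 < MInv) (haInv : 0 < aInv) (haW : 0 < aW) :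
    StepAnalyticPos dB c35 (fun j => geo9Y (f j)) (fun j => (codingYx G (f j) (C37 j) (C38 j)).bg)
      (fun j => KSCU G (f j) (par j) (C37 j) (C38 j)) (fun j => KACU G (f j) (OA j) (parB j) (C37 j) (C38 j))
      (fun j => pullS (codingYx G (f j) (C37 j) (C38 j)) (Cinv j))
      (fun j => IsAnKY G (f j) (par j) b (C37 j) (C38 j)) := by
  have h := stepAnalyticPos1_KSCU_on f c35 G par OA parB b ιB C37 C38 Cinv hι hG1 hpar hunit dB M₂ hM₂ hrepr hcR Cq hCq hC37 MInv aInv aW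
    hMInv haInv haW
  exact stepAnalyticPos_of_halves h h

end Hin

end Literature.MathematicalPhysics.QuantumFieldTheory.Balaban1983to89.B9SectBStepsKSCU

end
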